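import Summits.HodgeConjecture.HodgeConjecture.Theses.ELineTransport
import Summits.HodgeConjecture.HodgeConjecture.Theorems.NikulinTwinTransportRealMultiplicationOfHodgeConjecture
import Literature.AlgebraicGeometry.Surfaces.K3Marking
import Summits.HodgeConjecture.HodgeConjecture.Theorems.RigidRelativesJacobianTorelliHodgeIsoForcesRelativesNonzeroHodgeHomBijective
import Literature.AlgebraicGeometry.HodgeTheory.HodgeTypeProjectors
import Literature.AlgebraicGeometry.HodgeTheory.HodgeTypeOfFlatSections
import HarnessLib

/-!
# Crux `EClassOfSquareHodge` (stmt-HodgeConjecture-19048), line `birth` — stub `stub_typePreserving_of_EStructure`: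
# A RATIONAL, CUP-SELF-ADJOINT ENDOMORPHISM OF `H²` OF A SURFACE ACTING BY A REAL SCALAR ON `H^{2,0}` PRESERVES HODGE TYPES

Route `HodgeConjecture/ELineTransport`, piece X₂ `EClassOfSquareHodge` of the BC2 redirect of `IsogenyInvariance`
(stmt-HodgeConjecture-12550); registered skeleton `Cruxes/IsogenyInvariance/Lines/birth_EClassOfSquareHodge.lean`
(`EClassOfSquareHodge_of`: the sibling engine `Theorems.NikulinTwinTransport.hodgeEndomorphisms_induced_of_hodgeConjectureFor_square`
fed with `stub_K3_marking` — the named fact `Huybrechts_K3_marking_exists` — and `stub_typePreserving_of_EStructure`). This file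
closes the second stub, in fact for every smooth projective complex SURFACE and without the E-structure arithmetic:

**Theorem** (`isOfHodgeType_map_of_cupSelfAdjoint`). Let `S` be a smooth projective complex surface and `J` a `ℂ`-linear
endomorphism of `H²(S(ℂ); ℂ)` which (i) carries rational classes to rational classes, (ii) is self-adjoint for the cup
product `H² × H² → H⁴`, and (iii) acts on the `(2,0)`-classes by a REAL scalar `t`. Then `J` maps classes of type `(i, j)` to
classes of type `(i, j)`, for all `i, j`.
Proof. (i) makes `J` commute with complex conjugation (rational classes are real and span;
`Theorems.HodgeIsoForcesRelatives.conjClass_linearMap_apply`), so `J = t` on `H^{0,2} = conj H^{2,0}` as well (`t` real). For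
`x ∈ H^{1,1}` decompose `J x = y_{2,0} + y_{1,1} + y_{0,2}` in a Hodge model; by (ii), `J x ∪ conj y_{2,0} = x ∪ J(conj y_{2,0}) =
t · x ∪ conj y_{2,0}`, of type `(1,3)`, hence `0`; expanding, the only surviving term is `y_{2,0} ∪ conj y_{2,0}` (the others
have types `(1,3)`, `(0,4)`), so `y_{2,0} ∪ conj y_{2,0} = 0` and `y_{2,0} = 0` by the second Hodge–Riemann relation for
`(2,0)`-classes (`Theorems.RelativesTate.cup_conjClass_ne_zero_of_isOfHodgeType_n_zero`); symmetrically `y_{0,2} = 0`. Types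
off `{(2,0),(1,1),(0,2)}` carry only `0`.

§3 gives the stub in the registered spelling (its K3 clause, `J ∘ J = m` and `¬ IsSquare m` are not used), and the
skeleton's composition re-run with it discharged: `eClassOfSquareHodge_of_k3Marking : Huybrechts_K3_marking_exists →
Theses.ELineTransport.EClassOfSquareHodge` — the piece is now the K3 marking fact alone (Huybrechts Ch. 1 Prop. 3.5; in the tree
`Huybrechts_K3_marking_exists_holds_of`, open residue `b₂ = 22` + signature clause).

HONEST STATUS. Nothing here is a case of the Hodge conjecture; no definition, no named fact, no sorry.
References: [VoisinHodgeI2002] §6.3.2 Thm. 6.32, Cor. 6.12, Thm. 6.18, §7.1.1; [Huybrechts2016K3] Ch. 3 §2–3, Ch. 1 Prop. 3.5;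
[Zarhin1983HodgeGroupsK3] §1.
-/

noncomputable section

-- every declaration of this problem lives in `Summit.HodgeConjecture.HodgeConjecture.…` (summit = sub-problem)
set_option linter.dupNamespace false

open scoped Manifold
open CategoryTheory AlgebraicGeometry MonoidalCategory
open Literature.AlgebraicGeometry.Motives Literature.AlgebraicGeometry.HodgeTheory
open Literature.AlgebraicGeometry.Surfaces
open Literature.AlgebraicTopology.SingularHomology

namespace Summit.HodgeConjecture.HodgeConjecture.Theorems.EClassOfSquareHodge

variable {S : SchemeOver ℂ}

/-! ## §1 Hodge–Riemann for `(2,0)`-classes in the degree spelling `2 + 2` -/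

/-- **`u ∪ conj u ≠ 0` for a non-zero `(2,0)`-class on a smooth projective surface**, cup product read in `H^{2+2}`
(`Theorems.RelativesTate.cup_conjClass_ne_zero_of_isOfHodgeType_n_zero` at `n = 2`). [cite: VoisinHodgeI2002, §6.3.2 Thm. 6.32] -/
theorem cup_conjClass_ne_zero_two (hS : IsSmoothProjective 2 S) {s : ℕ} (h : 2 + 2 = s) {u : complexBetti S 2}
    (hu : IsOfHodgeType 2 S 2 2 0 u) (hne : u ≠ 0) : cupProduct h u (conjClass (ComplexPoints S) 2 u) ≠ 0 := by
  have hs : s = 2 * 2 := by omega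
  subst hs
  exact RelativesTate.cup_conjClass_ne_zero_of_isOfHodgeType_n_zero hS h hu hne

/-- The mirror statement: **`conj v ∪ v ≠ 0` for a non-zero `(0,2)`-class** (`w = conj v` is a non-zero `(2,0)`-class and
`conj v ∪ v = w ∪ conj w`). [cite: VoisinHodgeI2002, §6.3.2 Thm. 6.32 and Cor. 6.12] -/
theorem conjClass_cup_ne_zero_two (hS : IsSmoothProjective 2 S) {s : ℕ} (h : 2 + 2 = s) {v : complexBetti S 2}
    (hv : IsOfHodgeType 2 S 2 0 2 v) (hne : v ≠ 0) : cupProduct h (conjClass (ComplexPoints S) 2 v) v ≠ 0 := by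
  have hw : IsOfHodgeType 2 S 2 2 0 (conjClass (ComplexPoints S) 2 v) := hv.conjClass hS
  have h0 := cup_conjClass_ne_zero_two hS h hw (conjClass_ne_zero hne)
  rwa [conjClass_conjClass] at h0

/-! ## §2 The type-preservation theorem -/

/-- **`J = t` on `H^{0,2}` as soon as `J = t` on `H^{2,0}`, `t` real, `J` rational** (`J` commutes with conjugation).
[cite: VoisinHodgeI2002, Cor. 6.12 and §7.1.1] -/
theorem map_eq_smul_of_isOfHodgeType_zero_two (hS : IsSmoothProjective 2 S) (J : complexBetti S 2 →ₗ[ℂ] complexBetti S 2)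
    (hrat : ∀ c, IsRationalClass c → IsRationalClass (J c)) (t : ℝ)
    (h20 : ∀ c, IsOfHodgeType 2 S 2 2 0 c → J c = (t : ℂ) • c) {c : complexBetti S 2} (hc : IsOfHodgeType 2 S 2 0 2 c) :
    J c = (t : ℂ) • c := by
  have h1 : J (conjClass (ComplexPoints S) 2 c) = (t : ℂ) • conjClass (ComplexPoints S) 2 c := h20 _ (hc.conjClass hS)
  have h2 : conjClass (ComplexPoints S) 2 (J c) = (t : ℂ) • conjClass (ComplexPoints S) 2 c := by
    rw [HodgeIsoForcesRelatives.conjClass_linearMap_apply hS J hrat c, h1]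
  have h3 := congrArg (conjClass (ComplexPoints S) 2) h2
  rwa [conjClass_conjClass, conjClass_smul, conjClass_conjClass, Complex.conj_ofReal] at h3

/-- **A rational, cup-self-adjoint endomorphism of `H²(S(ℂ); ℂ)` acting by a real scalar on `H^{2,0}` preserves every Hodge type**
(`S` a smooth projective complex surface). [cite: VoisinHodgeI2002, §6.3.2 Thm. 6.32, Thm. 6.18 and §7.1.1]
[cite: Huybrechts2016K3, Ch. 3 §2–3] -/
theorem isOfHodgeType_map_of_cupSelfAdjoint (hS : IsSmoothProjective 2 S) (J : complexBetti S 2 →ₗ[ℂ] complexBetti S 2)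
    (hrat : ∀ c, IsRationalClass c → IsRationalClass (J c))
    (hsa : ∀ a b, cupProduct (rfl : 2 + 2 = 2 + 2) (J a) b = cupProduct (rfl : 2 + 2 = 2 + 2) a (J b)) (t : ℝ)
    (h20 : ∀ c, IsOfHodgeType 2 S 2 2 0 c → J c = (t : ℂ) • c) :
    ∀ (i j : ℕ) (x : complexBetti S 2), IsOfHodgeType 2 S 2 i j x → IsOfHodgeType 2 S 2 i j (J x) := by
  classical
  have hI := hodgePQ_independent_of_hodgeModel_holds
  obtain ⟨B⟩ := (nonempty_hodgeModel_holds (n := 2) (X := S)).nonempty hS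
  have hcup := cupPreservesHodgeType_of_hodgeModel hS B
  have h02 : ∀ {c : complexBetti S 2}, IsOfHodgeType 2 S 2 0 2 c → J c = (t : ℂ) • c :=
    fun hc ↦ map_eq_smul_of_isOfHodgeType_zero_two hS J hrat t h20 hc
  intro i j x hx
  -- off the antidiagonal, and beyond the dimension, there is only `0`
  by_cases hij : i + j = 2
  swap
  · have hx0 : x = 0 := hx.eq_zero_of_add_ne hij
    rw [hx0, map_zero, ← smul_zero (0 : ℂ), ← hx0]
    exact hx.smul 0
  -- `(i, j) ∈ {(2,0), (1,1), (0,2)}`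
  rcases Nat.lt_or_ge i 3 with hi | hi
  swap
  · exact absurd hij (by omega)
  interval_cases i
  · -- `(0, 2)`
    obtain rfl : j = 2 := by omega
    rw [h02 hx]
    exact hx.smul _
  swap
  · -- `(2, 0)`
    obtain rfl : j = 0 := by omega
    rw [h20 x hx]
    exact hx.smul _
  -- `(1, 1)`: decompose `y = J x` in the model `B`
  obtain rfl : j = 1 := by omega
  set y := J x with hy
  set yc : ↥(Finset.HasAntidiagonal.antidiagonal 2) → complexBetti S 2 := fun pq ↦ B.typeProj 2 pq y with hyc
  have hysum : ∑ pq, yc pq = y := B.sum_typeProj 2 y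
  have hyT : ∀ pq : ↥(Finset.HasAntidiagonal.antidiagonal 2), IsOfHodgeType 2 S 2 pq.1.1 pq.1.2 (yc pq) :=
    fun pq ↦ B.isOfHodgeType_of_mem_typePiece (B.typeProj_mem 2 pq y)
  -- the three indices
  let p20 : ↥(Finset.HasAntidiagonal.antidiagonal 2) := ⟨(2, 0), Finset.HasAntidiagonal.mem_antidiagonal.2 rfl⟩
  let p11 : ↥(Finset.HasAntidiagonal.antidiagonal 2) := ⟨(1, 1), Finset.HasAntidiagonal.mem_antidiagonal.2 rfl⟩
  let p02 : ↥(Finset.HasAntidiagonal.antidiagonal 2) := ⟨(0, 2), Finset.HasAntidiagonal.mem_antidiagonal.2 rfl⟩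
  have hcases : ∀ pq : ↥(Finset.HasAntidiagonal.antidiagonal 2), pq = p20 ∨ pq = p11 ∨ pq = p02 := by
    intro pq
    have h := Finset.HasAntidiagonal.mem_antidiagonal.1 pq.2
    rcases Nat.lt_or_ge pq.1.1 3 with h3 | h3
    · have : pq.1.1 = 0 ∨ pq.1.1 = 1 ∨ pq.1.1 = 2 := by omega
      rcases this with h0 | h1 | h2
      · right; right; exact Subtype.ext (Prod.ext h0 (by simp only [p02]; omega))
      · right; left; exact Subtype.ext (Prod.ext h1 (by simp only [p11]; omega))
      · left; exact Subtype.ext (Prod.ext h2 (by simp only [p20]; omega))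
    · exact absurd h (by omega)
  have hy20 : IsOfHodgeType 2 S 2 2 0 (yc p20) := hyT p20
  have hy11 : IsOfHodgeType 2 S 2 1 1 (yc p11) := hyT p11
  have hy02 : IsOfHodgeType 2 S 2 0 2 (yc p02) := hyT p02
  -- self-adjointness against a test class `z` with `J z = t z` and `x ∪ z = 0` gives `y ∪ z = 0`
  have htest : ∀ z : complexBetti S 2, J z = (t : ℂ) • z → cupProduct (rfl : 2 + 2 = 2 + 2) x z = 0 →
      cupProduct (rfl : 2 + 2 = 2 + 2) y z = 0 := by
    intro z hz hxz
    rw [hy, hsa x z, hz, map_smul, hxz, smul_zero]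
  -- expansion of `y ∪ z` along the decomposition
  have hexpand : ∀ z : complexBetti S 2,
      cupProduct (rfl : 2 + 2 = 2 + 2) y z = ∑ pq, cupProduct (rfl : 2 + 2 = 2 + 2) (yc pq) z := by
    intro z
    rw [← hysum, map_sum, LinearMap.sum_apply]
  -- (a) the `(2,0)`-component vanishes: test against `conj y₂₀`
  have h20zero : yc p20 = 0 := by
    by_contra hne
    set z := conjClass (ComplexPoints S) 2 (yc p20) with hz
    have hzT : IsOfHodgeType 2 S 2 0 2 z := hy20.conjClass hS
    have hxz : cupProduct (rfl : 2 + 2 = 2 + 2) x z = 0 := (hcup rfl hx hzT).eq_zero_of_lt hS (Or.inr (by omega))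
    have hyz := htest z (h02 hzT) hxz
    rw [hexpand z, Finset.sum_eq_single p20] at hyz
    · exact cup_conjClass_ne_zero_two hS rfl hy20 hne hyz
    · intro pq _ hpq
      rcases hcases pq with h | h | h
      · exact absurd h hpq
      · rw [h]; exact (hcup rfl hy11 hzT).eq_zero_of_lt hS (Or.inr (by omega))
      · rw [h]; exact (hcup rfl hy02 hzT).eq_zero_of_lt hS (Or.inr (by omega))
    · intro h; exact absurd (Finset.mem_univ _) h
  -- (b) the `(0,2)`-component vanishes: test against `conj y₀₂`
  have h02zero : yc p02 = 0 := by
    by_contra hne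
    set z := conjClass (ComplexPoints S) 2 (yc p02) with hz
    have hzT : IsOfHodgeType 2 S 2 2 0 z := hy02.conjClass hS
    have hxz : cupProduct (rfl : 2 + 2 = 2 + 2) x z = 0 := (hcup rfl hx hzT).eq_zero_of_lt hS (Or.inl (by omega))
    have hyz := htest z (h20 z hzT) hxz
    rw [hexpand z, Finset.sum_eq_single p02] at hyz
    · -- `y₀₂ ∪ conj y₀₂ = 0`: graded commutativity brings it to `conj y₀₂ ∪ y₀₂ = 0`
      have hcomm := cupProduct_gradedComm_holds ℂ (ComplexPoints S) (rfl : 2 + 2 = 2 + 2) rfl (yc p02) z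
      rw [hyz] at hcomm
      have hu : ((-1 : ℂ) ^ (2 * 2)) ≠ 0 := pow_ne_zero _ (neg_ne_zero.2 one_ne_zero)
      have h0 : cupProduct (rfl : 2 + 2 = 2 + 2) z (yc p02) = 0 := (smul_eq_zero_iff_right hu).1 hcomm.symm
      exact conjClass_cup_ne_zero_two hS rfl hy02 hne h0
    · intro pq _ hpq
      rcases hcases pq with h | h | h
      · rw [h]; exact (hcup rfl hy20 hzT).eq_zero_of_lt hS (Or.inl (by omega))
      · rw [h]; exact (hcup rfl hy11 hzT).eq_zero_of_lt hS (Or.inl (by omega))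
      · exact absurd h hpq
    · intro h; exact absurd (Finset.mem_univ _) h
  -- (c) hence `y = y₁₁`
  have hyeq : y = yc p11 := by
    rw [← hysum, Finset.sum_eq_single p11]
    · intro pq _ hpq
      rcases hcases pq with h | h | h
      · rw [h, h20zero]
      · exact absurd h hpq
      · rw [h, h02zero]
    · intro h; exact absurd (Finset.mem_univ _) h
  rw [hyeq]
  exact hy11

/-! ## §3 The stub, in the registered spelling, and the composition with it discharged -/

/-- **Stub `stub_typePreserving_of_EStructure` of crux `EClassOfSquareHodge` (registered signature, verbatim): an E-structure on
`H²` of a projective K3 surface — rational, `J ∘ J = m`, cup-self-adjoint, `J = +√m` on `H^{2,0}` — preserves Hodge types.**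
Only rationality, self-adjointness and the real scalar `√m` on `H^{2,0}` are used (`isOfHodgeType_map_of_cupSelfAdjoint`); the
K3 clause, `J ∘ J = m` and `¬ IsSquare m` are idle. [cite: VoisinHodgeI2002, §6.3.2 Thm. 6.32 and §7.1.1]
[cite: Huybrechts2016K3, Ch. 3 §2–3] -/
theorem stub_typePreserving_of_EStructure :
    ∀ (S : SchemeOver ℂ), (IsSmoothProjective 2 S ∧ Subsingleton (structureSheafCohomology S.left 1) ∧
      ∃ (A : HodgeModel 2 S) (η : Literature.Geometry.Kaehler.MForm 𝓘(ℝ, A.model) A.carrier ℂ 2),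
        Literature.Geometry.Kaehler.IsHolomorphicInCharts η ∧ ∀ x, η x ≠ 0) →
    ∀ m : ℕ, ¬ IsSquare m → ∀ J : complexBetti S 2 →ₗ[ℂ] complexBetti S 2,
      ((∀ c, IsRationalClass c → IsRationalClass (J c)) ∧ (∀ c, J (J c) = (m : ℂ) • c) ∧
        (∀ a b, cupProduct rfl (J a) b = cupProduct rfl a (J b)) ∧
        (∀ c, IsOfHodgeType 2 S 2 2 0 c → J c = (Real.sqrt m : ℂ) • c)) →
      ∀ (i j : ℕ) (x : complexBetti S 2), IsOfHodgeType 2 S 2 i j x → IsOfHodgeType 2 S 2 i j (J x) :=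
  fun _ hS _ _ J hJ ↦ isOfHodgeType_map_of_cupSelfAdjoint hS.1 J hJ.1 hJ.2.2.1 (Real.sqrt _) hJ.2.2.2

/-- **`EClassOfSquareHodge` from the K3 marking fact alone** (the skeleton's `EClassOfSquareHodge_of` with
`stub_typePreserving_of_EStructure` discharged): the sibling engine
`Theorems.NikulinTwinTransport.hodgeEndomorphisms_induced_of_hodgeConjectureFor_square` applied to `G := J`.
[cite: Huybrechts2016K3, Ch. 1 Prop. 3.5] [cite: VoisinHodgeI2002, §11.3.3 Lemma 11.41] -/
theorem eClassOfSquareHodge_of_k3Marking (hM : Huybrechts_K3_marking_exists) :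
    Summit.HodgeConjecture.HodgeConjecture.Theses.ELineTransport.EClassOfSquareHodge := by
  intro μ _ S hS m hm J hJ hHC
  exact Theorems.NikulinTwinTransport.hodgeEndomorphisms_induced_of_hodgeConjectureFor_square hM
    μ S hS hHC J hJ.1 (stub_typePreserving_of_EStructure S hS m hm J hJ)

end Summit.HodgeConjecture.HodgeConjecture.Theorems.EClassOfSquareHodge

end
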